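import Summits.HodgeConjecture.HodgeConjecture.Theorems.F0P3ClassificationKit      -- ★ T5-A p818801: `HasToken`, `Cinf`, `Gp`
import Summits.HodgeConjecture.HodgeConjecture.Theorems.F0P3ClassTokensOfRecord     -- ★ p819048: `Cls`, `cl`, `rep`, `rep_cl_areUnitarilyEquivalent`
import Summits.HodgeConjecture.HodgeConjecture.Theorems.F0P3ArchTokenSeam           -- ★ `areGKEquivalent_of_tokens` (two tokens of ONE `P`, F1a as hypothesis)
import Literature.NumberTheory.Automorphic.HarishChandraModuleIntertwiners          -- ★ `Intertwiner.harishChandraMap`, `harishChandraMap_repK`, `harishChandraMap_repLie` (bounded intertwiners induce `(𝔤, K)`-maps)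
import HarnessLib

/-!
# Crux `H413`, floor 0, programme F0P3 — THE ARCHIMEDEAN CLASS TOKEN OF RECORD `clInf₀` and law `TokenInf` AS A THEOREM (modulo F1a)

Cell hodgecm-mathlib (D-0151), sub-cell F0/P3 «U3-mult»; pen F0P3-p04 (g6); bid (c′-2) 2026-08-31 to F0P3-plan (g4) (census F0P4-p08 (g6)
09:35:08Z «`TokenInf` ⟸ pin + F1a»).  DEF lane (`--kind definition --supports stmt-HodgeConjecture-24833 --as helper`): one definition WITH
BODY (`clInfChoice`) and theorems; no instance, no notation, no named fact, no `sorry`; imports the ★ Theorems edition T5-A (never a `Lines`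
module).

WHAT.  In the frame `(ι, T, hT)` of the letters line, for the inner form `G′ = U(H)`:
* §1 **TOKENS TRANSPORT ALONG UNITARY EQUIVALENCE** `hasToken_of_areUnitarilyEquivalent`: if `P ≃ P′` unitarily (★ `AreUnitarilyEquivalent` of
  the closed invariant subspaces of `L²`) then every `H¹`-token `(M, σK, σ𝔤)` of `P` (★ T5-A `HasToken L H ι T hT μ P M σK σ𝔤`: a NON-ZERO
  `(𝔤, K)`-map `P.archModuleCM ι T hT → M`) is a token of `P′` — precompose with the restricted intertwiner of Harish-Chandra modules
  (★ `Intertwiner.harishChandraMap` of `HarishChandraModuleIntertwiners`, a `(𝔤, K)`-map; onto along an equivalence);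
* §2 **`clInfChoice dflt P : Cinf`** — the class (★ typ3 `GKIrrClass`) of SOME token of `P` if `P` has one, else the junk value `dflt`
  (an explicit parameter: no `Nonempty Cinf` is posited); `clInf₀ c := clInfChoice dflt (rep c)` is the kit field `clInf` at `𝔠₀`;
* §3 **`tokenInf_of_archIsotypy`** — law `TokenInf` of the dossier record (`Cruxes/H413/Lines/F0_T5InnerFormClassification.lean` :409) AT `𝔠₀`,
  modulo letter F1a for the `P` in hand: `(hF1a : P.ArchIsotypy (uFormGroup (Fin 2) (Fin 1)) (cmArchSectionUForm L ι H T hT)) → HasToken … P M σK σ𝔤 →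
  clInfChoice dflt (rep (cl P)) = GKIrrClass.ofModule M σK σ𝔤 hM hirr` — the chosen token of `rep (cl P) ≃ P` transports back to a token of
  `P` (§1), and two tokens of ONE `P` are `(𝔤, K)`-equivalent under F1a (★ `F0P3ArchTokenSeam.areGKEquivalent_of_tokens`); F1a is ★ in
  house for `(anti)holomorphic-cotangent `P` (★ `F0P3StubF1aCM.stubF1aCM_holds`) and is the hypothesis `hF1a` of the letters line's head otherwise.

References: [Rogawski1990] §14.6 (14.6.3), §15.3; [BorelWallach2000] 0 §2.4, I §2; [FlathCorvallis1979] Thm. 3–4; [WallachRRG1] §3.3.4.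
-/

set_option autoImplicit false
-- the mandated namespace has the single-problem summit's repeated segment (`HodgeConjecture.HodgeConjecture`)
set_option linter.dupNamespace false

-- Mathlib idiom (Mathlib/Algebra/Lie/OfAssociative.lean; as in ★ `GKModules` and every `(𝔤, K)` file of the tree):
-- the commutator bracket on `Module.End ℂ M`, needed to MENTION `𝔲(2,1) →ₗ⁅ℝ⁆ Module.End ℂ M`.
attribute [local instance 100] LieRing.ofAssociativeRing

noncomputable section

namespace Summit.HodgeConjecture.HodgeConjecture.Cruxes.H413.F0P3ArchClassTokenOfRecord

open MeasureTheory NumberField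
open scoped Matrix MatrixGroups ComplexOrder
open Literature.NumberTheory.Automorphic Literature.NumberTheory.Automorphic.UnitaryGroup
open Literature.RepresentationTheory.KonnoKonno2007 Literature.RepresentationTheory.KonnoKonno2007.RealDualPair
open Literature.RepresentationTheory.KonnoKonno2007.RealDualPair.UForm
open ContRepresentation (AreUnitarilyEquivalent)
open Summit.HodgeConjecture.HodgeConjecture.Cruxes.H413.F0P3InnerFormClassification (HasToken Cinf Gp)
open Summit.HodgeConjecture.HodgeConjecture.Cruxes.H413.F0P3ClassTokensOfRecord (Cls cl rep rep_cl_areUnitarilyEquivalent)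

variable (L : Type) [Field L] [NumberField L] [IsCMField L] (H : Matrix (Fin 3) (Fin 3) L) (ι : L →+* ℂ) (T : GL (Fin 3) ℂ)
  (hT : (T : Matrix (Fin 3) (Fin 3) ℂ)ᴴ * H.map ι * (T : Matrix (Fin 3) (Fin 3) ℂ) = Literature.Geometry.ComplexHyperbolic.BallModel.J)
  (μ : Measure (Gp L H).automorphicQuotient) [(Gp L H).IsAutomorphicMeasure μ]

/-! ## §1 Tokens transport along unitary equivalence -/

/-- An equivalence `e : P.space ≃ P′.space` of the closed invariant subspaces (as `G′(𝔸)`-representations) intertwines the archimedean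
restrictions `P.archRepCM ι T hT`, `P′.archRepCM ι T hT` along the CM section at `ι`. [cite: BorelWallach2000, 0 §2.4] [cite: WallachRRG1, §3.3.4] -/
theorem archRepCM_intertwines {P P' : DiscreteAutomorphicRep (Gp L H) μ} (e : P.space.toContRep.Equiv P'.space.toContRep) :
    ∀ (g : (uFormGroup (Fin 2) (Fin 1)).carrier) (v : P.space.toSubmodule),
      e.toContinuousLinearEquiv.toContinuousLinearMap (P.archRepCM ι T hT g v) = P'.archRepCM ι T hT g (e.toContinuousLinearEquiv.toContinuousLinearMap v) :=
  fun g v => DFunLike.congr_fun (e.isIntertwining (cmArchSectionUForm L ι H T hT g)) v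

/-- **The induced `(𝔤, K)`-map of archimedean modules** along an equivalence `e : P.space ≃ P′.space` (★ `Intertwiner.harishChandraMap` at
`π = P.archRepCM ι T hT`, `π′ = P′.archRepCM ι T hT`; `P.archModuleCM ι T hT` IS the Harish-Chandra space of `P.archRepCM ι T hT`).
[cite: BorelWallach2000, 0 §2.4 and §3.1] [cite: WallachRRG1, §3.3.4] -/
abbrev archModuleCMMap {P P' : DiscreteAutomorphicRep (Gp L H) μ} (e : P.space.toContRep.Equiv P'.space.toContRep) :
    P.archModuleCM ι T hT →ₗ[ℂ] P'.archModuleCM ι T hT :=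
  Intertwiner.harishChandraMap (uFormGroup (Fin 2) (Fin 1)) (archRepCM_intertwines L H ι T hT μ e)

/-- `archModuleCMMap e` is `e` on underlying vectors. [cite: WallachRRG1, §3.3.4] -/
theorem coe_archModuleCMMap_apply {P P' : DiscreteAutomorphicRep (Gp L H) μ} (e : P.space.toContRep.Equiv P'.space.toContRep)
    (v : P.archModuleCM ι T hT) : ((archModuleCMMap L H ι T hT μ e v : P'.archModuleCM ι T hT) : P'.space.toSubmodule) = e (v : P.space.toSubmodule) :=
  rfl

/-- `archModuleCMMap e.symm ∘ archModuleCMMap e = id`. [cite: WallachRRG1, §3.3.4] -/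
theorem archModuleCMMap_symm_apply_apply {P P' : DiscreteAutomorphicRep (Gp L H) μ} (e : P.space.toContRep.Equiv P'.space.toContRep)
    (v : P.archModuleCM ι T hT) : archModuleCMMap L H ι T hT μ e.symm (archModuleCMMap L H ι T hT μ e v) = v :=
  Subtype.ext (e.toContinuousLinearEquiv.symm_apply_apply (v : P.space.toSubmodule))

/-- `archModuleCMMap e` is surjective (its right inverse is `archModuleCMMap e.symm`). [cite: WallachRRG1, §3.3.4] -/
theorem archModuleCMMap_surjective {P P' : DiscreteAutomorphicRep (Gp L H) μ} (e : P.space.toContRep.Equiv P'.space.toContRep) :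
    Function.Surjective (archModuleCMMap L H ι T hT μ e) := fun w =>
  ⟨archModuleCMMap L H ι T hT μ e.symm w, by
    apply Subtype.ext
    exact e.toContinuousLinearEquiv.apply_symm_apply (w : P'.space.toSubmodule)⟩

/-- `archModuleCMMap e` intertwines the `K`-actions `archRepKCM`. [cite: WallachRRG1, §3.3.3] -/
theorem archModuleCMMap_repK {P P' : DiscreteAutomorphicRep (Gp L H) μ} (e : P.space.toContRep.Equiv P'.space.toContRep)
    (k : (uFormGroup (Fin 2) (Fin 1)).maximalCompact) (v : P.archModuleCM ι T hT) :
    archModuleCMMap L H ι T hT μ e (P.archRepKCM ι T hT k v) = P'.archRepKCM ι T hT k (archModuleCMMap L H ι T hT μ e v) :=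
  Intertwiner.harishChandraMap_repK (uFormGroup (Fin 2) (Fin 1)) (archRepCM_intertwines L H ι T hT μ e) k v

/-- `archModuleCMMap e` intertwines the derived `𝔲(2,1)`-actions `archRepLieCM` (★ `Intertwiner.harishChandraMap_repLie`). [cite: WallachRRG1, §1.6.2 and §3.3.4]
[cite: BorelWallach2000, 0 §3.1] -/
theorem archModuleCMMap_repLie {P P' : DiscreteAutomorphicRep (Gp L H) μ} (e : P.space.toContRep.Equiv P'.space.toContRep)
    (X : (uFormGroup (Fin 2) (Fin 1)).lie) (v : P.archModuleCM ι T hT) :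
    archModuleCMMap L H ι T hT μ e (P.archRepLieCM ι T hT X v) = P'.archRepLieCM ι T hT X (archModuleCMMap L H ι T hT μ e v) :=
  Intertwiner.harishChandraMap_repLie (uFormGroup (Fin 2) (Fin 1)) (archRepCM_intertwines L H ι T hT μ e)
    (P.isStronglyContinuous_archRep _ _ (continuous_cmArchSectionUForm L ι H T hT))
    (P'.isStronglyContinuous_archRep _ _ (continuous_cmArchSectionUForm L ι H T hT)) X v

/-- **TOKENS TRANSPORT ALONG UNITARY EQUIVALENCE.**  If `P ≃ P′` unitarily then an `H¹`-token `(M, σK, σ𝔤)` of `P` is a token of `P′`: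
`T₁ ∘ (e⁻¹)|` is a `(𝔤, K)`-map `P′.archModuleCM → M` and is non-zero because `(e⁻¹)|` is onto. [cite: BorelWallach2000, 0 §2.4 and I §2]
[cite: FlathCorvallis1979, Thm. 3 and Thm. 4] -/
theorem hasToken_of_areUnitarilyEquivalent {P P' : DiscreteAutomorphicRep (Gp L H) μ}
    (h : AreUnitarilyEquivalent P.space.toContRep P'.space.toContRep)
    {M : Type} [AddCommGroup M] [Module ℂ M] {σK : Representation ℂ (uFormGroup (Fin 2) (Fin 1)).maximalCompact M}
    {σ𝔤 : (uFormGroup (Fin 2) (Fin 1)).lie →ₗ⁅ℝ⁆ Module.End ℂ M}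
    (hP : HasToken L H ι T hT μ P M σK σ𝔤) : HasToken L H ι T hT μ P' M σK σ𝔤 := by
  obtain ⟨e, -⟩ := h
  obtain ⟨T₁, hK, h𝔤, hne⟩ := hP
  refine ⟨T₁ ∘ₗ archModuleCMMap L H ι T hT μ e.symm, ?_, ?_, ?_⟩
  · intro k w
    rw [LinearMap.comp_apply, LinearMap.comp_apply, archModuleCMMap_repK, hK]
  · intro X w
    rw [LinearMap.comp_apply, LinearMap.comp_apply, archModuleCMMap_repLie, h𝔤]
  · intro h0
    apply hne
    ext v
    obtain ⟨w, rfl⟩ := archModuleCMMap_surjective L H ι T hT μ e.symm v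
    have := LinearMap.congr_fun h0 w
    simpa only [LinearMap.comp_apply, LinearMap.zero_apply] using this

/-- Tokens of `P` and of `rep (cl P)` (the chosen representative of its class of record, ★ p819048) correspond. [cite: BorelWallach2000, 0 §2.4 and I §2] -/
theorem hasToken_rep_cl_iff (P : DiscreteAutomorphicRep (Gp L H) μ)
    {M : Type} [AddCommGroup M] [Module ℂ M] {σK : Representation ℂ (uFormGroup (Fin 2) (Fin 1)).maximalCompact M}
    {σ𝔤 : (uFormGroup (Fin 2) (Fin 1)).lie →ₗ⁅ℝ⁆ Module.End ℂ M} :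
    HasToken L H ι T hT μ (rep (Gp L H) μ (cl (Gp L H) μ P)) M σK σ𝔤 ↔ HasToken L H ι T hT μ P M σK σ𝔤 :=
  ⟨hasToken_of_areUnitarilyEquivalent L H ι T hT μ (rep_cl_areUnitarilyEquivalent (Gp L H) μ P),
    hasToken_of_areUnitarilyEquivalent L H ι T hT μ (rep_cl_areUnitarilyEquivalent (Gp L H) μ P).symm⟩

/-! ## §2 The archimedean class token of record -/

/-- **`clInfChoice dflt P`** — the archimedean class token of `P` at `ι`: the `(𝔤, K)`-isomorphism class (★ `GKIrrClass`) of SOME `H¹`-token of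
`P` when `P` has one, else the junk value `dflt`.  At `𝔠₀`: `clInf c := clInfChoice dflt (rep c)`.  [Rogawski1990 §14.6 (14.6.3): the
archimedean component `π′_∞` of `π′`; BorelWallach2000 I §2] -/
def clInfChoice (dflt : Cinf) (P : DiscreteAutomorphicRep (Gp L H) μ) : Cinf :=
  open scoped Classical in
  if h : ∃ r : GKIrrep (uFormGroup (Fin 2) (Fin 1)), HasToken L H ι T hT μ P r.V r.ρK r.ρ𝔤 then GKIrrClass.mk h.choose else dflt

/-- When `P` has a token, `clInfChoice dflt P` is the class of a token of `P`. [cite: BorelWallach2000, I §2] -/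
theorem exists_hasToken_clInfChoice_eq (dflt : Cinf) (P : DiscreteAutomorphicRep (Gp L H) μ)
    (h : ∃ r : GKIrrep (uFormGroup (Fin 2) (Fin 1)), HasToken L H ι T hT μ P r.V r.ρK r.ρ𝔤) :
    ∃ r : GKIrrep (uFormGroup (Fin 2) (Fin 1)), HasToken L H ι T hT μ P r.V r.ρK r.ρ𝔤 ∧ clInfChoice L H ι T hT μ dflt P = GKIrrClass.mk r := by
  classical
  refine ⟨h.choose, h.choose_spec, ?_⟩
  unfold clInfChoice
  rw [dif_pos h]

/-- Without tokens, `clInfChoice dflt P = dflt`. [cite: BorelWallach2000, I §2] -/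
theorem clInfChoice_of_not (dflt : Cinf) (P : DiscreteAutomorphicRep (Gp L H) μ)
    (h : ¬ ∃ r : GKIrrep (uFormGroup (Fin 2) (Fin 1)), HasToken L H ι T hT μ P r.V r.ρK r.ρ𝔤) :
    clInfChoice L H ι T hT μ dflt P = dflt := by
  classical
  unfold clInfChoice
  rw [dif_neg h]

/-! ## §3 Law `TokenInf` at `𝔠₀`, modulo F1a for the `P` in hand -/

/-- **`TokenInf` FOR `P` ITSELF**: under letter F1a for `P` along the CM section at `ι`, every token `(M, σK, σ𝔤)` of `P` has class
`clInfChoice dflt P` (two tokens of one `P` are `(𝔤, K)`-equivalent, ★ `areGKEquivalent_of_tokens`). [cite: FlathCorvallis1979, Thm. 3 and Thm. 4]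
[cite: Rogawski1990, §15.3] -/
theorem clInfChoice_eq_ofModule (dflt : Cinf) (P : DiscreteAutomorphicRep (Gp L H) μ)
    (hF1a : P.ArchIsotypy (uFormGroup (Fin 2) (Fin 1)) (cmArchSectionUForm L ι H T hT))
    {M : Type} [AddCommGroup M] [Module ℂ M] {σK : Representation ℂ (uFormGroup (Fin 2) (Fin 1)).maximalCompact M}
    {σ𝔤 : (uFormGroup (Fin 2) (Fin 1)).lie →ₗ⁅ℝ⁆ Module.End ℂ M} (hM : IsGKModule (uFormGroup (Fin 2) (Fin 1)) σK σ𝔤) (hirr : IsIrreducibleGK σK σ𝔤)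
    (htok : HasToken L H ι T hT μ P M σK σ𝔤) :
    clInfChoice L H ι T hT μ dflt P = GKIrrClass.ofModule M σK σ𝔤 hM hirr := by
  have hex : ∃ r : GKIrrep (uFormGroup (Fin 2) (Fin 1)), HasToken L H ι T hT μ P r.V r.ρK r.ρ𝔤 := ⟨⟨M, σK, σ𝔤, hM, hirr⟩, htok⟩
  obtain ⟨r, hr, hreq⟩ := exists_hasToken_clInfChoice_eq L H ι T hT μ dflt P hex
  rw [hreq, GKIrrClass.ofModule_eq_mk, GKIrrClass.mk_eq_mk_iff]
  obtain ⟨T₁, hT₁K, hT₁𝔤, hT₁⟩ := hr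
  obtain ⟨T₂, hT₂K, hT₂𝔤, hT₂⟩ := htok
  exact F0P3ArchTokenSeam.areGKEquivalent_of_tokens ι T hT P hF1a r.isIrreducible T₁ hT₁K hT₁𝔤 hT₁ hirr T₂ hT₂K hT₂𝔤 hT₂

/-- **LAW `TokenInf` AT `𝔠₀`** (dossier record :409, with `clInf c := clInfChoice dflt (rep c)`), modulo letter F1a for the `P` in hand:
a token `(M, σK, σ𝔤)` of `P` pins `clInfChoice dflt (rep (cl P)) = GKIrrClass.ofModule M σK σ𝔤` — the chosen token of `rep (cl P)` is a token
of `P` (§1, `P ≃ rep (cl P)`), and tokens of one `P` are `(𝔤, K)`-equivalent under F1a. [cite: FlathCorvallis1979, Thm. 3 and Thm. 4]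
[cite: Rogawski1990, §14.6 (14.6.3) and §15.3] [cite: BorelWallach2000, I §2] -/
theorem tokenInf_of_archIsotypy (dflt : Cinf) (P : DiscreteAutomorphicRep (Gp L H) μ)
    (hF1a : P.ArchIsotypy (uFormGroup (Fin 2) (Fin 1)) (cmArchSectionUForm L ι H T hT))
    {M : Type} [AddCommGroup M] [Module ℂ M] {σK : Representation ℂ (uFormGroup (Fin 2) (Fin 1)).maximalCompact M}
    {σ𝔤 : (uFormGroup (Fin 2) (Fin 1)).lie →ₗ⁅ℝ⁆ Module.End ℂ M} (hM : IsGKModule (uFormGroup (Fin 2) (Fin 1)) σK σ𝔤) (hirr : IsIrreducibleGK σK σ𝔤)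
    (htok : HasToken L H ι T hT μ P M σK σ𝔤) :
    clInfChoice L H ι T hT μ dflt (rep (Gp L H) μ (cl (Gp L H) μ P)) = GKIrrClass.ofModule M σK σ𝔤 hM hirr := by
  have hex : ∃ r : GKIrrep (uFormGroup (Fin 2) (Fin 1)), HasToken L H ι T hT μ (rep (Gp L H) μ (cl (Gp L H) μ P)) r.V r.ρK r.ρ𝔤 :=
    ⟨⟨M, σK, σ𝔤, hM, hirr⟩, (hasToken_rep_cl_iff L H ι T hT μ P).2 htok⟩
  obtain ⟨r, hr, hreq⟩ := exists_hasToken_clInfChoice_eq L H ι T hT μ dflt _ hex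
  rw [hreq, GKIrrClass.ofModule_eq_mk, GKIrrClass.mk_eq_mk_iff]
  -- both `r` (transported back to `P`) and `M` are tokens of `P`
  obtain ⟨T₁, hT₁K, hT₁𝔤, hT₁⟩ := (hasToken_rep_cl_iff L H ι T hT μ P).1 hr
  obtain ⟨T₂, hT₂K, hT₂𝔤, hT₂⟩ := htok
  exact F0P3ArchTokenSeam.areGKEquivalent_of_tokens ι T hT P hF1a r.isIrreducible T₁ hT₁K hT₁𝔤 hT₁ hirr T₂ hT₂K hT₂𝔤 hT₂

/-- The same with the law's binder order (`∀ P M σK σ𝔤 hM hirr, HasToken … → clInf (cl P) = …`) for a family of F1a hypotheses over the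
token-carrying `P` — the shape the ED. 4 closer feeds. [cite: FlathCorvallis1979, Thm. 3 and Thm. 4] [cite: Rogawski1990, §14.6 (14.6.3)] -/
theorem tokenInf_of_archIsotypy_family (dflt : Cinf)
    (hF1a : ∀ P : DiscreteAutomorphicRep (Gp L H) μ,
      (∃ r : GKIrrep (uFormGroup (Fin 2) (Fin 1)), HasToken L H ι T hT μ P r.V r.ρK r.ρ𝔤) →
        P.ArchIsotypy (uFormGroup (Fin 2) (Fin 1)) (cmArchSectionUForm L ι H T hT))
    (P : DiscreteAutomorphicRep (Gp L H) μ) (M : Type) [AddCommGroup M] [Module ℂ M]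
    (σK : Representation ℂ (uFormGroup (Fin 2) (Fin 1)).maximalCompact M) (σ𝔤 : (uFormGroup (Fin 2) (Fin 1)).lie →ₗ⁅ℝ⁆ Module.End ℂ M)
    (hM : IsGKModule (uFormGroup (Fin 2) (Fin 1)) σK σ𝔤) (hirr : IsIrreducibleGK σK σ𝔤) (htok : HasToken L H ι T hT μ P M σK σ𝔤) :
    clInfChoice L H ι T hT μ dflt (rep (Gp L H) μ (cl (Gp L H) μ P)) = GKIrrClass.ofModule M σK σ𝔤 hM hirr :=
  tokenInf_of_archIsotypy L H ι T hT μ dflt P (hF1a P ⟨⟨M, σK, σ𝔤, hM, hirr⟩, htok⟩) hM hirr htok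

end Summit.HodgeConjecture.HodgeConjecture.Cruxes.H413.F0P3ArchClassTokenOfRecord

end
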